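import Summits.BirchSwinnertonDyer.BirchSwinnertonDyer.Theorems.SignedLowerHalvesSmallImageLowerHalfBothSignsRttD2SeqSemilocFrobEval
import Literature.NumberTheory.GaloisCohomology.PoitouTateFiniteUnramifiedTransport
import Literature.NumberTheory.GaloisRepresentations.ContinuousCohomologyConnectingNaturality
import Literature.NumberTheory.GaloisRepresentations.HochschildSerreLowDegree
import HarnessLib

/-!
# Route `SignedLowerHalves`, crux L `SmallImageLowerHalfBothSigns` (stmt-BirchSwinnertonDyer-23599), line `rtt_w3` v32 — stub S3β″ (`stub_junctionPT_ns`), input N5-(iii)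
# (unramified generator), component C3′: THE FROBENIUS-VALUE RELATION ON `H¹(Γ_F, B)` — `c` IS THE UNRAMIFIED CLASS WITH VALUE `b` AT `φ`

WIDTH seat `bsd-line-slh-p3-w3` g27 under LEAD `cruxlead-stmt-BirchSwinnertonDyer-23599` g14 (cell `bsd-ssimc`); helper `--supports stmt-BirchSwinnertonDyer-23599`
(plan `Lines/rtt_w3-DESIGN-N5iii-w3-g26.md` §2 C3/C4/C7). ONE DEFINITION WITH BODY (`IsFrobValue`, a `Prop`) + THEOREMS; no named fact, no instance, no `sorry`.
HONEST FRAMING: generic local Galois cohomology. For a non-archimedean local field `F`, a finite discrete `Γ_F`-module `B` on which the inertia group acts trivially and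
`φ ∈ Γ_F` of Frobenius degree one, the relation `IsFrobValue τ φ c b` («`c ∈ H¹(Γ_F, B)` is inflated from a cocycle of `Γ_F/I_F` whose value at `φ̄` is `b`») is the graph of
the evaluation isomorphism `H¹_ur(F, B) ≅ B/(φ − 1)B` (g26 C3 `oneCocycleClass_eq_iff_exists_apply_frob`, `exists_contOneCocycles_apply_frob_eq`, tree `infOne`,
`infOne_injective`, `infOne_exact_resSubgroup`, `cohomologyMap_infOne`): it is total on `B`, lands in the unramified classes and exhausts them, is additive, detects equality
of classes modulo `(φ − 1)B`, and is NATURAL in the module. This is the device by which the unramified generators `u_{w,n,k}` of the semilocal levels are defined and their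
`Λ_𝒪`-annihilators computed (next files). Nothing about S3β″, crux L or BSD is proved; all remain OPEN and are proved for NO curve.

* `IsFrobValue τ φ c b` — the relation.
* `exists_isFrobValue` (every `b` is a value), `IsFrobValue.mem_unramifiedSubgroup`, `exists_isFrobValue_of_mem_unramifiedSubgroup` (every unramified class has a value),
  `IsFrobValue.add`/`zero`/`neg`/`sub`, ★ `IsFrobValue.eq_iff` (`c = c′ ↔ ∃ y, b − b′ = φ y − y`), `IsFrobValue.eq_zero_iff`, `IsFrobValue.eq_of_eq` (the class is determined by
  the value), ★ `IsFrobValue.map` (naturality under `H¹(η)` for a morphism `η` of modules).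
References: [SerreLocalFields1979] XIII §1 Prop. 1; [MilneADT2006] I §2 Lemma 2.9; [SerreGaloisCohomology1997] I §2.6 (b); [NeukirchSchmidtWingberg2008] (1.6.2), (7.1.2).
-/

set_option autoImplicit false
set_option linter.dupNamespace false -- D-0017: single-problem summit, the namespace repeats the problem name by design
noncomputable section

open CategoryTheory Function
open Field IsNonarchimedeanLocalField ValuativeRel

universe u

namespace Summit.BirchSwinnertonDyer.BirchSwinnertonDyer.Theorems.SmallImageRttD2Seq

open Literature.NumberTheory.GaloisRepresentations Literature.NumberTheory.GaloisRepresentations.DiscreteGaloisModule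
  Literature.NumberTheory.GaloisCohomology.PoitouTateFinite.GaloisImage
open _root_.TopRep _root_.ContRepresentation _root_.ContinuousCohomology

variable {F : Type u} [Field F] [ValuativeRel F] [TopologicalSpace F] [IsNonarchimedeanLocalField F]
variable {B : Type u} [AddCommGroup B] [TopologicalSpace B] [DiscreteTopology B]
variable (τ : DiscreteGaloisModule F B) (φ : absoluteGaloisGroup F)

/-- **`c ∈ H¹(Γ_F, B)` IS THE UNRAMIFIED CLASS WITH VALUE `b` AT `φ`**: `c` is the inflation of the class of a continuous cocycle `z` of `Γ_F / Gal(F̄/F^nr)` with coefficients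
in `B^{Gal(F̄/F^nr)}` whose value at the image of `φ` is `b`. (For `φ` a Frobenius and inertia acting trivially this is the graph of `H¹_ur(F, B) ≅ B/(φ − 1)B`.)
[cite: SerreLocalFields1979, XIII §1 Prop. 1] [cite: MilneADT2006, I §2 Lemma 2.9] -/
def IsFrobValue (c : galoisCohomology τ 1) (b : B) : Prop :=
  ∃ z : contOneCocycles (ContinuousRep.quotientInvariants (galUnr F) τ).toTopRep,
    (infOne (galUnr F) τ (oneCocycleClass _ z) : galoisCohomology τ 1) = c ∧ (z.1 (QuotientGroup.mk φ) : B) = b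

namespace IsFrobValue

variable {τ φ}

/-- The zero class has value `0`. [folklore] -/
theorem zero : IsFrobValue τ φ 0 0 := by
  refine ⟨0, ?_, rfl⟩
  have h0 : oneCocycleClass (ContinuousRep.quotientInvariants (galUnr F) τ).toTopRep 0 = 0 :=
    map_zero (oneCocycleClassₗ (R := ℤ) (ContinuousRep.quotientInvariants (galUnr F) τ).toTopRep)
  rw [h0, map_zero]
  rfl

/-- Additivity of the relation. [folklore] -/
theorem add {c c' : galoisCohomology τ 1} {b b' : B} (h : IsFrobValue τ φ c b) (h' : IsFrobValue τ φ c' b') :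
    IsFrobValue τ φ (c + c') (b + b') := by
  obtain ⟨z, hz, hzb⟩ := h
  obtain ⟨z', hz', hzb'⟩ := h'
  refine ⟨z + z', ?_, ?_⟩
  · rw [oneCocycleClass_add, map_add, hz, hz']
    rfl
  · rw [← hzb, ← hzb']
    rfl

/-- Compatibility with negation. [folklore] -/
theorem neg {c : galoisCohomology τ 1} {b : B} (h : IsFrobValue τ φ c b) : IsFrobValue τ φ (-c) (-b) := by
  obtain ⟨z, hz, hzb⟩ := h
  refine ⟨-z, ?_, ?_⟩
  · have hn : oneCocycleClass (ContinuousRep.quotientInvariants (galUnr F) τ).toTopRep (-z) =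
        -oneCocycleClass (ContinuousRep.quotientInvariants (galUnr F) τ).toTopRep z :=
      map_neg (oneCocycleClassₗ (R := ℤ) (ContinuousRep.quotientInvariants (galUnr F) τ).toTopRep) z
    rw [hn, map_neg, hz]
    rfl
  · rw [← hzb]
    rfl

/-- Compatibility with subtraction. [folklore] -/
theorem sub {c c' : galoisCohomology τ 1} {b b' : B} (h : IsFrobValue τ φ c b) (h' : IsFrobValue τ φ c' b') :
    IsFrobValue τ φ (c - c') (b - b') := by
  rw [sub_eq_add_neg, sub_eq_add_neg]
  exact h.add h'.neg

/-- ★ **NATURALITY**: a morphism `η : B → B′` of discrete `Γ_F`-modules carries the class with value `b` at `φ` to the class with value `η b` (`H¹(η) ∘ Inf = Inf ∘ H¹(η^I)`,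
`cohomologyMap_infOne`). [cite: SerreGaloisCohomology1997, I §2.6] [cite: NeukirchSchmidtWingberg2008, (1.5.2)] -/
theorem map {B' : Type u} [AddCommGroup B'] [TopologicalSpace B'] [DiscreteTopology B'] {τ' : DiscreteGaloisModule F B'} (η : τ.toTopRep ⟶ τ'.toTopRep)
    {c : galoisCohomology τ 1} {b : B} (h : IsFrobValue τ φ c b) :
    IsFrobValue τ' φ (cohomologyMap η 1 c) (η.hom b) := by
  obtain ⟨z, hz, hzb⟩ := h
  refine ⟨contOneCocycles.pullback (ContinuousMonoidHom.id _) (resIdHom (ContinuousRep.invariantsHom (N := galUnr F) η)) z, ?_, ?_⟩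
  · have e := cohomologyMap_oneCocycleClass (ContinuousRep.invariantsHom (N := galUnr F) η) z
    rw [← e, ← cohomologyMap_infOne, hz]
  · rw [contOneCocycles.pullback_apply, ← hzb]
    rfl

variable [Finite B]

/-- ★ **Two Frobenius-valued classes agree iff their values agree modulo `(φ − 1)B`** (inflation is injective; C3 `oneCocycleClass_eq_iff_exists_apply_frob`), for `φ` of Frobenius
degree one and inertia acting trivially on `B`. [cite: SerreLocalFields1979, XIII §1 Prop. 1] [cite: SerreGaloisCohomology1997, I §2.6 (b)] -/
theorem eq_iff (hI : ∀ σ ∈ absInertia F, ∀ b : B, τ σ b = b) (hφ : IsFrobPow φ 1) {c c' : galoisCohomology τ 1} {b b' : B}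
    (h : IsFrobValue τ φ c b) (h' : IsFrobValue τ φ c' b') : c = c' ↔ ∃ y : B, b - b' = τ φ y - y := by
  obtain ⟨z, hz, hzb⟩ := h
  obtain ⟨z', hz', hzb'⟩ := h'
  haveI : Finite (ContinuousRep.invariantsOf (galUnr F) τ) := Subtype.finite
  have key := oneCocycleClass_eq_iff_exists_apply_frob F (ContinuousRep.quotientInvariants (galUnr F) τ) hφ z z'
  constructor
  · intro hcc
    have hzz : oneCocycleClass _ z = oneCocycleClass _ z' := infOne_injective (galUnr F) τ (by rw [hz, hz', hcc])
    obtain ⟨y, hy⟩ := key.1 hzz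
    refine ⟨(y : B), ?_⟩
    have h1 := congrArg (fun t : ContinuousRep.invariantsOf (galUnr F) τ ↦ (t : B)) hy
    simp only [AddSubgroupClass.coe_sub, hzb, hzb', ContinuousRep.quotientInvariants_apply_coe] at h1
    exact h1
  · rintro ⟨y, hy⟩
    have hymem : y ∈ ContinuousRep.invariantsOf (galUnr F) τ := fun n ↦ hI n (by rw [← galUnr_eq_absInertia F]; exact n.2) y
    rw [← hz, ← hz']
    refine congrArg _ (key.2 ⟨⟨y, hymem⟩, Subtype.ext ?_⟩)
    simp only [AddSubgroupClass.coe_sub, hzb, hzb', ContinuousRep.quotientInvariants_apply_coe]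
    exact hy

/-- `c = 0 ↔ b ∈ (φ − 1)B` for a class with value `b`. [cite: SerreLocalFields1979, XIII §1 Prop. 1] -/
theorem eq_zero_iff (hI : ∀ σ ∈ absInertia F, ∀ b : B, τ σ b = b) (hφ : IsFrobPow φ 1) {c : galoisCohomology τ 1} {b : B} (h : IsFrobValue τ φ c b) :
    c = 0 ↔ ∃ y : B, b = τ φ y - y := by
  rw [h.eq_iff hI hφ zero]
  simp only [sub_zero]

/-- **The class is determined by its value** (values equal ⇒ classes equal). [cite: SerreLocalFields1979, XIII §1 Prop. 1] -/
theorem eq_of_eq (hI : ∀ σ ∈ absInertia F, ∀ b : B, τ σ b = b) (hφ : IsFrobPow φ 1) {c c' : galoisCohomology τ 1} {b : B}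
    (h : IsFrobValue τ φ c b) (h' : IsFrobValue τ φ c' b) : c = c' :=
  (h.eq_iff hI hφ h').2 ⟨0, by rw [sub_self, map_zero, sub_self]⟩

omit [Finite B] in
/-- **Frobenius-valued classes are unramified** (`Inf` followed by `Res` to the inertia group is zero). [cite: SerreGaloisCohomology1997, I §2.6 (b)] [cite: MilneADT2006, I §2] -/
theorem mem_unramifiedSubgroup (hI : ∀ σ ∈ absInertia F, ∀ b : B, τ σ b = b) {c : galoisCohomology τ 1} {b : B} (h : IsFrobValue τ φ c b) :
    c ∈ DiscreteGaloisModule.unramifiedSubgroup τ 1 := by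
  obtain ⟨z, hz, -⟩ := h
  obtain ⟨ψ, hψ⟩ := oneCocycleClass_surjective τ.toTopRep c
  have key : resSubgroup τ.toTopRep (galUnr F) 1 (oneCocycleClass τ.toTopRep ψ) = 0 := by
    have e : oneCocycleClass τ.toTopRep ψ = infOne (galUnr F) τ (oneCocycleClass _ z) := hψ.trans hz.symm
    rw [e]
    exact (infOne_exact_resSubgroup (galUnr F) τ).apply_apply_eq_zero _
  exact hψ ▸ (mem_unramifiedSubgroup_one_iff_resSubgroup_galUnr_eq_zero τ hI ψ).2 key

end IsFrobValue

variable [Finite B]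

/-- ★ **Every `b ∈ B` is the value at `φ` of an (unramified) class** (C3 `exists_contOneCocycles_apply_frob_eq` on `B = B^{I_F}`). [cite: SerreLocalFields1979, XIII §1 Prop. 1]
[cite: MilneADT2006, I §2 Lemma 2.9] -/
theorem exists_isFrobValue (hI : ∀ σ ∈ absInertia F, ∀ b : B, τ σ b = b) (hφ : IsFrobPow φ 1) (b : B) : ∃ c : galoisCohomology τ 1, IsFrobValue τ φ c b := by
  haveI : Finite (ContinuousRep.invariantsOf (galUnr F) τ) := Subtype.finite
  have hb : b ∈ ContinuousRep.invariantsOf (galUnr F) τ := fun n ↦ hI n (by rw [← galUnr_eq_absInertia F]; exact n.2) b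
  obtain ⟨z, hz⟩ := exists_contOneCocycles_apply_frob_eq F (ContinuousRep.quotientInvariants (galUnr F) τ) hφ ⟨b, hb⟩
  exact ⟨_, z, rfl, by rw [hz]⟩

omit [Finite B] in
/-- ★ **Every unramified class has a value at `φ`** (inflation–restriction: `H¹_ur = Inf H¹(Γ_F/I_F, B)`). [cite: SerreGaloisCohomology1997, I §2.6 (b)] [cite: MilneADT2006, I §2] -/
theorem exists_isFrobValue_of_mem_unramifiedSubgroup (hI : ∀ σ ∈ absInertia F, ∀ b : B, τ σ b = b) {c : galoisCohomology τ 1}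
    (hc : c ∈ DiscreteGaloisModule.unramifiedSubgroup τ 1) : ∃ b : B, IsFrobValue τ φ c b := by
  obtain ⟨ψ, rfl⟩ := oneCocycleClass_surjective τ.toTopRep c
  have h0 := (mem_unramifiedSubgroup_one_iff_resSubgroup_galUnr_eq_zero τ hI ψ).1 hc
  obtain ⟨x, hx⟩ := ((infOne_exact_resSubgroup (galUnr F) τ) _).1 h0
  obtain ⟨z, rfl⟩ := oneCocycleClass_surjective _ x
  exact ⟨_, z, hx, rfl⟩

end Summit.BirchSwinnertonDyer.BirchSwinnertonDyer.Theorems.SmallImageRttD2Seq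

end
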